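import Summits.ResolutionOfSingularities.ResolutionOfSingularities.Theorems.MarkedTransferCampaignW46TypedProcedure
import HarnessLib

/-!
# [OURS · L1 W4.6 / W4.7] Pure-logic anchors of the typed-procedure module — companion of
# `Theorems/MarkedTransferCampaignW46TypedProcedure.lean` (cell res-hironaka, LADDER-RESOLUTION rung L, D-0089;
# campaigns s46 / s47; host route MarkedTransfer, `--supports stmt-ResolutionOfSingularities-16155`)

HONEST FRAMING. Nothing here is a statement of H. Hironaka's manuscript (2017-03-23, [Hironaka2017]) and nothing here
asserts that any statement of it holds. These are THEOREMS OF PURE LOGIC about the OURS definitions of the companion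
module (`CampaignW46.Resume`, `IsCentre`, `Step`, `DecreaseAlongSteps`, `Terminates`, `primeR`) and the typed CANDIDATE
carriers they are built over; a typed candidate claim occurs only as the HYPOTHESIS `h : S16Proof.Thm16_6 …` of
`decreaseAlongSteps_of_thm16_6`. Typed by res-L1-type-o1 (statement-only lane; plan/SIZED-ASK-L.md v0.2 §U). AI review
is weaker than expert review. No `sorry`; axioms standard.

## Contents

* `Resume.mti_isStandard` — the row-019 résumé of a résumé satisfies the hypothesis `MTIDatum.IsStandard` of the typed
  `Thm16_6` (v3): from row 091 `YStep.isStandard` / `YSequence.E_zero` and row 016 `ARStructure.isStandard_F/_H`.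
* `IsCentre.isPermissibleCentre`, `IsCentre.isCentrePermE` — under the résumé's Def. 15.12 inclusion hypotheses the
  LITERAL centre rule of Th. 16.6 gives a §2.1-permissible centre for `E` (DESIGN POINT (CTR) of the companion).
* `decreaseAlongSteps_of_thm16_6` — THE ANCHOR: the typed candidate `S16Proof.Thm16_6 n (primeR N Rd) _` implies
  `DecreaseAlongSteps N Rd Rg` for every regime `Rg`; i.e. every W4.6 rung `Campaign.Thm16_6_2_ours_<regime>` is the
  reading-R instance of the typed Th. 16.6 (2) RESTRICTED to its regime, and a W4.7 negation refutes exactly that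
  reading in that regime — no more.
* `decreaseAlongSteps_antitone`, `terminates_antitone` — monotonicity in the regime.
* `terminates_iff_not_diverges`, `not_terminates_of_divergesFrom`, `diverges_iff_exists_divergesFrom` — the W4.7
  divergence shapes against `Terminates` (a divergent family from a state in the regime refutes termination there).

## References

* companion module docstring; plan/SIZED-ASK-L.md v0.2 §S S-s46/S-s47, §U; H. Hironaka, ms. 2017-03-23, Th. 16.6
  p.84 l.4–32, Def. 15.12 p.80 l.37 – p.81 l.2, §2.1 p.4 l.37–39, p.6 l.37–38 — scope only, under adjudication, not
  cited as fact. [Hironaka2017]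
-/

noncomputable section

set_option linter.dupNamespace false -- mandated namespace of this single-conjunct summit

open CategoryTheory AlgebraicGeometry TopologicalSpace

namespace Summit.ResolutionOfSingularities.ResolutionOfSingularities.Theorems

namespace CampaignW46

open Literature.AlgebraicGeometry.Resolution
open Literature.AlgebraicGeometry.Hironaka2017.S02Preliminaries
open Literature.AlgebraicGeometry.Hironaka2017.Datum
open Literature.AlgebraicGeometry.Hironaka2017.S15ARSchemes
open Literature.AlgebraicGeometry.Hironaka2017.S16Proof

universe u

variable {n : ℕ} {p : ℕ} [Fact p.Prime] {K : Type u} [Field K] [CharP K p]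

namespace Resume

variable {N : Notions.{u} n} {A : AmbientDatum p K} {E : IdealExponent A.Z} (R : Resume N A E)

/-- Pure logic: the row-019 résumé of a résumé satisfies the §2 standing condition `MTIDatum.IsStandard` (hypothesis of
the typed `Thm16_6` v3): `E = E(0)` is standard by the step datum of stage `0` (row 091 `YStep.isStandard`, `E_zero`),
and every member — an `F_j` or an AR-extension `H_{ji}` of the AR-scheme `𝔜(i)` — is standard by Def. 15.1 (row 016
`ARStructure.isStandard_F` / `isStandard_H`). [folklore] -/
theorem mti_isStandard : R.mti.IsStandard := by
  refine ⟨?_, ?_⟩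
  · have h0 : (R.𝒴.E_ 0).IsStandard := (R.𝒴.step 0).isStandard
    rw [R.𝒴.E_zero] at h0
    exact h0
  · intro i a
    rcases a with j | ⟨j, i'⟩
    · exact (R.𝒴.step i).𝒴.str.isStandard_F j
    · exact (R.𝒴.step i).𝒴.str.isStandard_H j i'

end Resume

section Centre

variable {N : Notions.{u} n} {A : AmbientDatum p K} {E : IdealExponent A.Z}

/-- Pure logic (DESIGN POINT (CTR)): under the résumé's Def. 15.12 inclusion hypotheses `∇(E) ⊆ Sing(Ě) ⊆ Sing(E)`
a centre of the literal rule is a permissible centre for `E` in the sense of §2.1 (row 001). [folklore] -/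
theorem IsCentre.isPermissibleCentre {R : Resume N A E} {D : Closeds A.Z} (h : IsCentre R D) :
    E.IsPermissibleCentre A.hom D where
  irreducible := h.irreducible
  smooth := h.smooth
  subset_sing := by
    have hi : Def15_12_incl_1 R.T ((R.𝒴.step 0).Echeck.sing) ∧ Def15_12_incl_2 E ((R.𝒴.step 0).Echeck.sing) :=
      R.nabla_incl
    exact h.subset_nabla.trans (hi.1.trans hi.2)

/-- Pure logic: the literal rule together with the résumé's hypotheses gives the permE rule. [folklore] -/
theorem IsCentre.isCentrePermE {R : Resume N A E} {D : Closeds A.Z} (h : IsCentre R D) : IsCentrePermE R D :=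
  ⟨h.subset_nabla, h.isPermissibleCentre⟩

end Centre

/-- **Anchor (pure logic).** The typed candidate Th. 16.6 (`S16Proof.Thm16_6`, any part-(4) parameter), with its
`prime` parameter read as `primeR N Rd`, implies `DecreaseAlongSteps N Rd Rg` for EVERY regime: each W4.6 rung is that
reading of the candidate RESTRICTED to its regime (so a rung proved is banked architecture, a rung refuted — W4.7 — is a
refutation of that reading of the candidate in that regime, nothing more). [folklore] -/
theorem decreaseAlongSteps_of_thm16_6 [PerfectField K] (N : Notions.{u} n) (Rd : Reading p K N)
    {pPosiEmptyAt : ∀ {W : Scheme.{u}}, IdealExponent W → W → Prop}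
    (h : Thm16_6 (p := p) (K := K) n (primeR N Rd) pPosiEmptyAt) (Rg : Regime p K) : DecreaseAlongSteps N Rd Rg := by
  intro A E R _ _ A' s R' hR'
  have key := h A R.mti s.D s.π (fun _ => R'.mti) R.mti_isStandard s.centre.subset_nabla s.centre.irreducible
    s.centre.smooth s.blowup ⟨A'.hom, A'.irreducible, A'.smooth, A'.quasiCompact, R', hR', fun _ => rfl⟩
  exact key.2.1

/-- Pure logic: shrinking the regime weakens the one-step shape. [folklore] -/
theorem decreaseAlongSteps_antitone {N : Notions.{u} n} {Rd : Reading p K N} {Rg₁ Rg₂ : Regime p K}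
    (hle : ∀ A E, Rg₁ A E → Rg₂ A E) (h : DecreaseAlongSteps N Rd Rg₂) : DecreaseAlongSteps N Rd Rg₁ :=
  fun A E R h₁ hRd A' s R' hR' => h A E R (hle A E h₁) hRd A' s R' hR'

/-- Pure logic: shrinking the regime weakens termination. [folklore] -/
theorem terminates_antitone {N : Notions.{u} n} {Rd : Reading p K N} {Rg₁ Rg₂ : Regime p K}
    (hle : ∀ A E, Rg₁ A E → Rg₂ A E) (h : Terminates N Rd Rg₂) : Terminates N Rd Rg₁ :=
  fun r hr => h r fun k => hle _ _ (hr k)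

/-- Pure logic: termination in a regime is the absence of a divergent run in it. [folklore] -/
theorem terminates_iff_not_diverges {N : Notions.{u} n} {Rd : Reading p K N} {Rg : Regime p K} :
    Terminates N Rd Rg ↔ ¬ Diverges N Rd Rg :=
  ⟨fun h ⟨r, hr⟩ => h r hr, fun h r hr => h ⟨r, hr⟩⟩

/-- Pure logic: a divergent run from a state in the regime refutes termination in that regime (how a W4.7 family kills a
W4.6-type termination statement — for the SAME notion instance `N`, reading `Rd` and a regime containing the family).
[folklore] -/
theorem not_terminates_of_divergesFrom {N : Notions.{u} n} {Rd : Reading p K N} {Rg : Regime p K}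
    {A₀ : AmbientDatum p K} {E₀ : IdealExponent A₀.Z} (h : DivergesFrom N Rd Rg A₀ E₀) : ¬ Terminates N Rd Rg := by
  obtain ⟨r, hr⟩ := h
  exact fun hT => hT r.toRun hr

/-- Pure logic: conversely a divergent run is a divergent run from its own stage `0`. [folklore] -/
theorem diverges_iff_exists_divergesFrom {N : Notions.{u} n} {Rd : Reading p K N} {Rg : Regime p K} :
    Diverges N Rd Rg ↔ ∃ (A₀ : AmbientDatum p K) (E₀ : IdealExponent A₀.Z), DivergesFrom N Rd Rg A₀ E₀ := by
  constructor
  · rintro ⟨r, hr⟩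
    refine ⟨r.A 0, r.E 0, ⟨⟨fun k => r.A (k + 1), fun k => ?_, ?_, ?_, ?_, ?_, ?_⟩, ?_⟩⟩
    · exact match k with
        | 0 => r.E 0
        | k + 1 => r.E (k + 1)
    · rfl
    · exact fun k => match k with
        | 0 => r.R 0
        | k + 1 => r.R (k + 1)
    · exact fun k => match k with
        | 0 => r.reads 0
        | k + 1 => r.reads (k + 1)
    · exact fun k => match k with
        | 0 => r.step 0
        | k + 1 => r.step (k + 1)
    · intro k
      match k with
      | 0 => exact r.E_succ 0
      | k + 1 => exact r.E_succ (k + 1)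
    · intro k
      match k with
      | 0 => exact hr 0
      | k + 1 => exact hr (k + 1)
  · rintro ⟨A₀, E₀, h⟩
    obtain ⟨r, hr⟩ := h
    exact ⟨r.toRun, hr⟩

/-! ## Anchors for the ∇-centred runs (appended with the companion's D1 section, 2026-08-26) -/

/-- Pure logic: every ∇-centred run is a run, so sub-centre termination implies ∇-centred termination (the converse is
what D1 refutes in general). [folklore] -/
theorem terminatesNabla_of_terminates {N : Notions.{u} n} {Rd : Reading p K N} {Rg : Regime p K}
    (h : Terminates N Rd Rg) : TerminatesNabla N Rd Rg :=
  fun r hr => h r.toRun hr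

/-- Pure logic: ∇-centred termination in a regime is the absence of a ∇-centred divergent run in it. [folklore] -/
theorem terminatesNabla_iff_not_divergesNabla {N : Notions.{u} n} {Rd : Reading p K N} {Rg : Regime p K} :
    TerminatesNabla N Rd Rg ↔ ¬ DivergesNabla N Rd Rg :=
  ⟨fun h ⟨r, hr⟩ => h r hr, fun h r hr => h ⟨r, hr⟩⟩

/-- Pure logic: a ∇-centred divergent run from a state in the regime refutes ∇-centred termination there (how a W4.7 (a′)
family would kill a W4.6 termination rung — same `N`, `Rd`, regime). [folklore] -/
theorem not_terminatesNabla_of_divergesFromNabla {N : Notions.{u} n} {Rd : Reading p K N} {Rg : Regime p K}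
    {A₀ : AmbientDatum p K} {E₀ : IdealExponent A₀.Z} (h : DivergesFromNabla N Rd Rg A₀ E₀) :
    ¬ TerminatesNabla N Rd Rg := by
  obtain ⟨r, hr⟩ := h
  exact fun hT => hT r.toRunNabla hr

/-- Pure logic: shrinking the regime weakens ∇-centred termination. [folklore] -/
theorem terminatesNabla_antitone {N : Notions.{u} n} {Rd : Reading p K N} {Rg₁ Rg₂ : Regime p K}
    (hle : ∀ A E, Rg₁ A E → Rg₂ A E) (h : TerminatesNabla N Rd Rg₂) : TerminatesNabla N Rd Rg₁ :=
  fun r hr => h r fun k => hle _ _ (hr k)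

/-- Pure logic: a ∇-step's centre is in particular admitted by the literal rule, and — under the résumé's Def. 15.12
hypotheses — a §2.1-permissible centre for `E`. [folklore] -/
theorem StepNabla.isPermissibleCentre {N : Notions.{u} n} {A A' : AmbientDatum p K} {E : IdealExponent A.Z}
    {R : Resume N A E} (s : StepNabla R A') : E.IsPermissibleCentre A.hom s.D :=
  s.centre.isPermissibleCentre

/-! ## Anchors for the reading sibling (M⁺) `m := t + 1` (appended with the companion's v4 section, 2026-08-27)

Pure logic relating the (M⁺) twins `Resume.mSucc` / `mtiSucc` / `invStrSucc`, `Step.DecreaseSucc` / `LengthLeSucc`,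
`DecreaseAlongStepsSucc`, `primeRSucc` of the companion module to the (M) decls and to the typed candidate `S16Proof.Thm16_6`:
the (M⁺) string is the (M) string followed by the entry `Inv_ξ(𝒴(t))` of the terminal stage; «`m′ ≤ m`» is the same
condition under both readings; the (M⁺) one-step shape is the typed candidate with `prime := primeRSucc` restricted to the
regime. Nothing of the manuscript is asserted. -/

section ReadingSuccAnchors

namespace Resume

variable {N : Notions.{u} n} {A : AmbientDatum p K} {E : IdealExponent A.Z} (R : Resume N A E)

/-- Pure logic: under (M⁺) the number of stops is positive (the (M)-edge `m = 0` never arises). [folklore] -/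
theorem mSucc_pos : 0 < R.mSucc :=
  Nat.succ_pos _

/-- Pure logic (definitional bookkeeping): `mSucc = m + 1`. [folklore] -/
theorem mSucc_eq : R.mSucc = R.m + 1 :=
  rfl

/-- Pure logic (definitional bookkeeping): the (M⁺) row-019 résumé has the same ideal exponent as the (M) one. [folklore] -/
theorem mtiSucc_E : R.mtiSucc.E = R.mti.E :=
  rfl

/-- Pure logic (definitional bookkeeping): … the same terminal plat `∇`. [folklore] -/
theorem mtiSucc_nabla : R.mtiSucc.nabla = R.mti.nabla :=
  rfl

/-- Pure logic (definitional bookkeeping): … the same `Inv`-slot. [folklore] -/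
theorem mtiSucc_invY : R.mtiSucc.invY = R.mti.invY :=
  rfl

/-- Pure logic (definitional bookkeeping): … number of stops `t + 1`. [folklore] -/
theorem mtiSucc_m : R.mtiSucc.m = R.mSucc :=
  rfl

/-- Pure logic (definitional bookkeeping): … hence the same locus `D′ = ∇′ ∩ π⁻¹(D)` of Eq. (127) (row 019
`MTIDatum.DPrime` depends on `∇` only). [folklore] -/
theorem mtiSucc_DPrime {Z' : Scheme.{u}} (π : Z' ⟶ A.Z) (D : Closeds A.Z) :
    R.mtiSucc.DPrime π D = R.mti.DPrime π D :=
  rfl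

/-- Pure logic: the (M⁺) row-019 résumé satisfies the §2 standing condition `MTIDatum.IsStandard` (same members as
`Resume.mti`). [folklore] -/
theorem mtiSucc_isStandard : R.mtiSucc.IsStandard :=
  R.mti_isStandard

/-- Pure logic: THE (M)/(M⁺) DICTIONARY at a point — the (M⁺) `Inv`-string `(Inv_ξ(𝒴(0)), …, Inv_ξ(𝒴(t)))` is the (M)
string `(Inv_ξ(𝒴(0)), …, Inv_ξ(𝒴(t−1)))` followed by the terminal-stage entry `Inv_ξ(𝒴(t))` (`List.range_succ`).
[folklore] -/
theorem invStrSucc_eq (ξ : A.Z) : R.invStrSucc ξ = R.invStr ξ ++ [R.invY R.m ξ] := by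
  simp only [invStrSucc, invStr, MTIDatum.invStr, mSucc, List.range_succ, List.map_append, List.map_cons,
    List.map_nil]
  rfl

/-- Pure logic: the (M⁺) string has length `t + 1`. [folklore] -/
theorem length_invStrSucc (ξ : A.Z) : (R.invStrSucc ξ).length = R.m + 1 := by
  simp [invStrSucc, MTIDatum.invStr, mSucc_eq]

end Resume

section StepSucc

variable {N : Notions.{u} n} {A A' : AmbientDatum p K} {E : IdealExponent A.Z} {R : Resume N A E} (s : Step R A')

/-- Pure logic: «`m′ ≤ m`» is the same condition under (M⁺) and (M) (`t′ + 1 ≤ t + 1 ↔ t′ ≤ t`; same locus). [folklore] -/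
theorem Step.lengthLeSucc_iff (R' : Resume N A' s.E') : s.LengthLeSucc R' ↔ s.LengthLe R' := by
  simp only [Step.LengthLeSucc, Step.LengthLe, Thm16_6_2_mle]
  exact forall_congr' fun _ => forall_congr' fun _ => forall_congr' fun _ => forall_congr' fun _ =>
    Nat.succ_le_succ_iff

/-- Pure logic: the (M⁺) one-step decrease, unfolded to the point — at every closed `ξ′` over `D` off `D′` the (M⁺) strings
compare by row 019's 0-padded `InvString.LexLT`; stated with the (M)/(M⁺) dictionary substituted on both sides, so that a
rung file can discharge it from string data. [folklore] -/
theorem Step.decreaseSucc_iff (R' : Resume N A' s.E') :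
    s.DecreaseSucc R' ↔ ∀ ξ' : A'.Z, ξ' ∈ Literature.AlgebraicGeometry.Hironaka2017.S02Preliminaries.closedPoints A'.Z → s.π ξ' ∈ (s.D : Set A.Z) →
      ξ' ∉ R.mti.DPrime s.π s.D →
        InvString.LexLT (R'.invStr ξ' ++ [R'.invY R'.m ξ']) (R.invStr (s.π ξ') ++ [R.invY R.m (s.π ξ')]) := by
  simp only [Step.DecreaseSucc, Thm16_6_2, Eq127]
  refine forall_congr' fun ξ' => forall_congr' fun _ => forall_congr' fun _ => forall_congr' fun _ => ?_
  rw [← Resume.invStrSucc_eq, ← Resume.invStrSucc_eq]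
  rfl

end StepSucc

/-- **Anchor (pure logic), reading (M⁺).** The typed candidate Th. 16.6 (`S16Proof.Thm16_6`, any part-(4) parameter) with
its `prime` parameter read as `primeRSucc N Rd` implies `DecreaseAlongStepsSucc N Rd Rg` for EVERY regime — twin of
`decreaseAlongSteps_of_thm16_6`: an (M⁺) rung is that reading of the candidate RESTRICTED to its regime. [folklore] -/
theorem decreaseAlongStepsSucc_of_thm16_6 [PerfectField K] (N : Notions.{u} n) (Rd : Reading p K N)
    {pPosiEmptyAt : ∀ {W : Scheme.{u}}, IdealExponent W → W → Prop}
    (h : Thm16_6 (p := p) (K := K) n (primeRSucc N Rd) pPosiEmptyAt) (Rg : Regime p K) :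
    DecreaseAlongStepsSucc N Rd Rg := by
  intro A E R _ _ A' s R' hR'
  have key := h A R.mtiSucc s.D s.π (fun _ => R'.mtiSucc) R.mtiSucc_isStandard s.centre.subset_nabla
    s.centre.irreducible s.centre.smooth s.blowup ⟨A'.hom, A'.irreducible, A'.smooth, A'.quasiCompact, R', hR', fun _ => rfl⟩
  exact key.2.1

/-- Pure logic: shrinking the regime weakens the (M⁺) one-step shape. [folklore] -/
theorem decreaseAlongStepsSucc_antitone {N : Notions.{u} n} {Rd : Reading p K N} {Rg₁ Rg₂ : Regime p K}
    (hle : ∀ A E, Rg₁ A E → Rg₂ A E) (h : DecreaseAlongStepsSucc N Rd Rg₂) : DecreaseAlongStepsSucc N Rd Rg₁ :=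
  fun A E R h₁ hRd A' s R' hR' => h A E R (hle A E h₁) hRd A' s R' hR'

/-- Pure logic: the «`m′ ≤ m`» halves of the (M) and (M⁺) one-step shapes agree along all steps of a regime. [folklore] -/
theorem lengthLeAlongSteps_succ_iff {N : Notions.{u} n} {Rd : Reading p K N} {Rg : Regime p K} :
    (∀ (A : AmbientDatum p K) (E : IdealExponent A.Z) (R : Resume N A E), Rg A E → Rd A E R →
      ∀ (A' : AmbientDatum p K) (s : Step R A') (R' : Resume N A' s.E'), Rd A' s.E' R' → s.LengthLeSucc R') ↔
    (∀ (A : AmbientDatum p K) (E : IdealExponent A.Z) (R : Resume N A E), Rg A E → Rd A E R →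
      ∀ (A' : AmbientDatum p K) (s : Step R A') (R' : Resume N A' s.E'), Rd A' s.E' R' → s.LengthLe R') := by
  simp only [Step.lengthLeSucc_iff]

/-- Pure logic: `Regime.singFinite` combined by `Regime.inter` is monotone bookkeeping — a state of `Rg ⊓ singFinite` is a
state of `Rg`. [folklore] -/
theorem Regime.inter_singFinite_le (Rg : Regime p K) :
    ∀ (A : AmbientDatum p K) (E : IdealExponent A.Z), Regime.inter Rg Regime.singFinite A E → Rg A E :=
  fun _ _ h => h.1

end ReadingSuccAnchors

end CampaignW46

end Summit.ResolutionOfSingularities.ResolutionOfSingularities.Theorems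

end
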